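import Literature.MathematicalPhysics.QuantumFieldTheory.Balaban1983to89.B2Eq267HiggsRegion
import Literature.MathematicalPhysics.QuantumFieldTheory.Balaban1983to89.B2Eq273GaugeCovariance
import Literature.MathematicalPhysics.QuantumFieldTheory.Balaban1983to89.B2Ineq329CovariantAveraging

/-!
# `Balaban1983to89.B2Eq276HiggsRegion` — [Balaban1982Higgs2] Lemma 2.4, proof steps **(2.75)** («a_kG_k(□, 0)Q_k^*1 = … =
# 1 − m²(Lᵏε)²G_k(□, 0)Q_k^*1») EXACTLY and **(2.76)** («(a_kG_k(□, 0)Q_k^*□₁φ′)(x) = φ′(y) + O(p(Lᵏε)), x ∈ Bᵏ(y)») AT THE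
# ZERO FIELD, p. 573, ON THE (Higgs)₂,₃ CARRIER OF RECORD (the typer's (2.56) `B2Eq255Concrete.bgScalar256` with Neumann
# conditions on `□ = Bᵏ(□₂)`), plus the transporter bookkeeping «U(A₀(Γ_{x,y}))φ(y) = U(A^{(k)}(Γ_{x,y}))φ(y) + O(…)» of the
# last display before (2.77)

statement-level skeleton of published theorems with citation tags; proofs where landed; nothing here is a claim
about the Yang–Mills mass gap

PDF held: `paper:balaban1982-cmp86-higgs23-ii` (journal page = PDF page + 554), p. 573 [PDF 19] (text layer p0019 L18–34,
re-read this session; the display (2.75) is unreadable in the text layer and is quoted from the seat's gen-5 verbatim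
transcription in `B2Eq268GaugeAway`'s module docstring, second-read by r14 `SECONDREAD-B2.md`), p. 571 [PDF 17] (2.62)–(2.63).

CITATION HEADER (lean-in-tree rule).  T. Bałaban, *(Higgs)₂,₃ quantum fields in a finite volume. II. An upper bound*,
Commun. Math. Phys. **86** (1982) 555–594, doi:10.1007/bf01214890 [Balaban1982Higgs2]; operators of T. Bałaban, *(Higgs)₂,₃
quantum fields in a finite volume. I. A lower bound*, Commun. Math. Phys. **85** (1982) 603–626 [Balaban1982Higgs1] AS TYPED
by the typer (`HiggsLattice`, `HiggsAveraging`, `HiggsCovariance`, `HiggsCovariancePos`, `B2Eq255Concrete`).  Cell `lit-balaban`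
(HOME `run/shared/lean/pub/lit-balaban/`), Phase-2 proof seat **p23** gen 21 (unit `lit-balaban-p23-g21`; free-target protocol
G.5-34(d), TAKING #3 line HOME/STATUS.md 2026-08-23T02:44:24Z); SKELETON row **B2.Lem2.4** (Lemma 2.4 (2.65)–(2.66) p. 572; fold
owner r02, second reader r14; decl of record `B2.Lemma24Printed`, head `proved p250408 · …` UNCHANGED — cells-only member;
brick F3′ of the seat's programme «(2.68)/(2.65) on the (Higgs)₂,₃ carrier of record», after F1 = own `B2Eq273GaugeCovariance`
p348673 ✓ 77f594e2c6c4 and F2 = own `B2Eq273NeumannLocality` p349421 ✓ 01aafa818c0b).  Cross-references: rows **B2.Prop2.2** ((2.58) — p17's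
`B2Ineq258HiggsRegion.ineq258_GQ_higgs_region_coarse`, the input of §2), **B2.Lem2.3** ((2.62)–(2.63): the whole-torus zero-field
constants `B2Lemma23HiggsLattice.{covOpK,propagatorK}_zeroField_const` — §1 is their REGION version), **B2.Eq2.55** ((2.56)),
**B1.Eq2.20**, **B1.Eq2.1**.  USED BY NAME, never restated: the typer's `B2Eq255Concrete.{bgScalar256, bgScalar256_eq, cutTo,
cutTo_of_mem, cutTo_of_not_mem, underRegion, mem_underRegion}`, `B2Eq267HiggsRegion.bgScalar256_apply_eq_sum`, p17's
`B2Ineq258HiggsRegion.{ineq258_GQ_higgs_region_coarse, chi_smul_avgQkAdj_single}`, p15's `B2Ineq329ZeroAveraging.{avgQk_zero_apply,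
multiContourSum_zero_field}` and `B2Ineq329CovariantAveraging.norm_U_apply_sub_le`, r14's `B1Eq353SupNorm.card_blockK`,
`B2Eq230CondShiftBound.sum_exp_neg_tdist_le` with `B4Sect5Proof.latticeConst`, `HiggsCovariancePos.propagatorK_covOpK_apply`,
own `B2Eq273GaugeCovariance.{constVec, cornerGauge, contourSum_constVec, U_cornerGauge, U_angle_eq, U_add_apply}`, own gen 9
`B2Ineq329PrismHolonomy.{val_steps, val_toFinest_blockIter, sum_steps_le, abs_multiContourSum_le, blockIter_stair_src,
multiContourSum_sub}`.

WHAT IS PRINTED (p. 573 [PDF 19]).  *«Now let us consider the restrictions (2.55) on the field φ. The estimates of the covariant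
derivatives give us |U(A^{(k)}(⟨y′, y″⟩))φ(y″) − φ(y′)| ≤ O(1)p(Lᵏε). After the gauge transformation we finally get
|U(A₀(Γ_{y′,y}))U(A₀(Γ_{y,y″}))φ′(y″) − U(A₀(Γ_{y′,y}))φ′(y′)| = |φ′(y″) − φ′(y′)| ≤ O(1)p(Lᵏε). Now we can apply the same reasoning
to the configuration a_kG_k(□, 0)Q_k^*□₁φ′ as to A^{(k)} in the proof of Lemma 2.3, especially we have
a_kG_k(□, 0)Q_k^*1 = G_k(□, 0)(−Δ^{η,N}_{0,□} + m²(Lᵏε) + a_kP_k□)1 − m²(Lᵏε)²G_k(□, 0)Q_k^*1 = 1 − m²(Lᵏε)²G_k(□, 0)Q_k^*1, (2.75)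
so the same conclusion holds and we get (a_kG_k(□, 0)Q_k^*□₁φ′)(x) = φ′(y) + O(p(Lᵏε)), x ∈ Bᵏ(y). (2.76) Combining the equalities
(2.67), (2.68), (2.74), (2.76) and taking into account the equalities φ′(y) = φ(y), U(A₀(Γ_{x,y}))φ(y) = U(A^{(k)}(Γ_{x,y}))φ(y) +
O((Lᵏε)^{κ₀}) we finally get (2.65).»*; p. 571 (proof of Lemma 2.3): *«G_kQ_k^*1 = a_k⁻¹G_ka_kP_kQ_k^*1 = a_k⁻¹G_k(−Δ + a_kP_k +
m²(Lᵏε)²)1 − a_k⁻¹m²(Lᵏε)²G_kQ_k^*1, G_kQ_k^*1 = 1/(a_k + m²(Lᵏε)²) (2.62) … = (1 − m²(Lᵏε)²/(a_k + m²(Lᵏε)²))A(y) + … (2.63)»*.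

THE ARGUMENT (print's, on the carrier; ε-lattice currency: `ℓ = Lᵏε = P.mesh k`, `m² ↦ msq`, `a_kP_k ↦ a_kℓ⁻²P_k`).
(2.75): on `Ω = Bᵏ(□₂)` the field `w = 1_Ω·v` (= `Q_k^*(0)(1_{□₂}v)`, `U(0) = 1`) satisfies `Q_k(0)w = 1_{□₂}v` (`|Bᵏ(y)| = Lᵏᵈ`,
`k ≤ K`), `P_k(0)w = w`, `−Δ^{ε,N}_{0,Ω}w = 0` (both ends of a bond inside `Ω` carry `v`), so `H_k(Ω,0)w = (m² + a_kℓ⁻²)w`,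
`G^ε_k(Ω,0)w = (m² + a_kℓ⁻²)⁻¹w` (`m² > 0`, `a_k ≥ 0`), `a_kℓ⁻²G^ε_k(Ω,0)Q_k^*(1_{□₂}v) = (a_k/(a_k + m²ℓ²))·w` — the typer's
(2.56) of the CONSTANT unit-lattice field on `□₁ = □₂` is the constant `a_k/(a_k + m²ℓ²)` of (2.62)–(2.63) on `Ω`.  (2.76): by
linearity `(a_kG_k(□,0)Q_k^*□₁φ′)(x) − (a_k/(a_k+m²ℓ²))φ′(ȳ) = a_kℓ⁻²[Σ_{y′∈□₁}(G_kQ_k^*δ_{y′}(φ′(y′) − φ′(ȳ)))(x) −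
Σ_{y′∈□₂∖□₁}(G_kQ_k^*δ_{y′}φ′(ȳ))(x)]` for `x ∈ Ω`, `ȳ = x_k`; each term is bounded by Prop. 2.2 (2.58) AT `A = 0` ((I.2.23) holds
with constant `0`) — `c₀e^{1/(2K₀)}ℓ²e^{−|ȳ−y′|/(2K₀)}` times `|φ′(y′) − φ′(ȳ)| ≤ λ|ȳ − y′|` on `□₁` (print's «|φ′(y″) − φ′(y′)| ≤
O(1)p(Lᵏε)» per unit step) resp. times `|φ′(ȳ)|` with `|ȳ − y′| ≥ ρ` on `□₂ ∖ □₁`; `τe^{−τ/(2K₀)} ≤ 4K₀e^{−τ/(4K₀)}` and the lattice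
sum `Σ_{y′}e^{−|ȳ−y′|/(4K₀)} ≤ K_d(1/(4K₀))` give `a_k·c₀e^{1/(2K₀)}K_d·(4K₀λ + e^{−ρ/(4K₀)}|φ′(ȳ)|)`.  TRANSPORTERS: for the constant
field `A₀ = constVec c`, `A₀(Γ^{(k)}_{ȳ,x}) = Σ_μ (x_μ − ȳ_μ)c_μ = ε⁻¹(λ_o(x) − λ_o(ȳ))` when the block of `x` does not wrap past the
corner `o` (`λ_o` = F1's `cornerGauge`), so `U(A₀(Γ_{x,o}))·U(λ_o(ȳ))φ(ȳ) = U(A₀(Γ^{(k)}_{x,ȳ}))φ(ȳ) = (Q_k^*(A₀)φ)(x)` — the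
rotations of (2.74) and of «φ′(y) = U(A₀(Γ_{y,·}))φ(y)» compose to print's `U(A₀(Γ_{x,y}))φ(y)`; and `|U(A₀(Γ^{(k)}_{x,ȳ}))w −
U(A(Γ^{(k)}_{x,ȳ}))w| ≤ |e|·ε·d(Lᵏ − 1)·sup_{b ⊂ Bᵏ(ȳ)}|A_b − A₀,_b|·|w|` (length of `Γ^{(k)}` < dLᵏ, `‖U(εea) − 1‖ ≤ |εea|`).

WHAT THIS FILE PROVES (kernel-checked, zero `sorry`; theorems only — NO definition, NO `Prop`-valued fact; axioms standard).
 §1 (2.75) EXACT on `Ω = Bᵏ(□₂)`: `avgQkAdj_zero_cutTo_const` (`Q_k^*(0)(1_{□₂}v) = 1_Ω v`), `avgQkLin_zero_cutTo_const`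
    (`Q_k(0)(1_Ω v) = 1_{□₂}v`), `projPk_zero_cutTo_const`, `covLaplacianN_zero_cutTo_const` (any `Ω`), **`covOpK_zero_cutTo_const`**,
    **`propagatorK_zero_cutTo_const`**, **`eq275_printed`** (`a_kℓ⁻²G w = w − m²G w`, the display), **`eq275_region`** /
    `eq275_region_apply` (`bgScalar256 C msq a k □₂ □₂ 0 (v·1) = (a_k/(a_k + m²ℓ²))·1_Ω v`).
 §2 (2.76) AT `A = 0`: **`eq276_zero_region`** (p35-format quantifiers `∃ K₀min ∀ K₀ ≥ K₀min ∃ C ∀ P …`; hypotheses: `Ω = Bᵏ(□₂)`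
    a big-block union, `x` `R₀`-deep in `Ω`, `□₁ ⊆ □₂`, `φ′` `λ`-Lipschitz about `ȳ` on `□₁` in the (1.3) distance, `□₂ ∖ □₁` at
    distance `≥ ρ` from `ȳ`), and `norm_sub_le_of_sub_kappa` (passing from the constant `a_k/(a_k+m²ℓ²)` to print's `φ′(y)`).
 §3 TRANSPORTERS: **`multiContourSum_constVec`** (`A₀(Γ^{(k)}_{ȳ,x}) = Σ_μ(x_μ − ȳ_μ)c_μ`, `k ≤ K`),
    **`contourSum_constVec_sub`** (`A₀(Γ_{o,x}) − A₀(Γ_{o,ȳ}) = A₀(Γ^{(k)}_{ȳ,x})`, no wrap), **`transport_cornerGauge_eq_avgQkAdj`**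
    (`U(A₀(Γ_{x,o}))(U(λ_o(ȳ))φ(ȳ)) = (Q_k^*(A₀)φ)(x)`), **`norm_avgQkAdj_sub_avgQkAdj_le`** (`|(Q_k^*(A)ψ)(x) − (Q_k^*(B)ψ)(x)| ≤
    |e|εd(Lᵏ−1)·s·|ψ(ȳ)|` when `|A − B| ≤ s` on the bonds starting in `Bᵏ(ȳ)`).

HONEST SCOPE / DIFFERENCES FROM PRINT (recorded, not hidden).  (a) §1 is exact algebra with `m² > 0`, `a_k ≥ 0`, `k ≤ K`; print's
«Q_k^*1» on `□` is the carrier's `Q_k^*(0)` of the cut constant `1_{□₂}v`, and print's unit-lattice `m²(Lᵏε)²`, `a_kP_k` are the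
carrier's `msq`, `a_kℓ⁻²P_k` (ε-currency; the printed first line's «m²(Lᵏε)» without the square is a misprint, cf. (2.62)).
(b) §2 is (2.76) at the ZERO vector field only, with print's `O(p(Lᵏε))` replaced by the explicit right side in terms of a Lipschitz
constant `λ` of `φ′` about `ȳ` on `□₁`, the separation `ρ` of `□₂ ∖ □₁` from `ȳ`, and `|φ′(ȳ)|`; the constants `c₀`, `K₀min` are
those of p17's (2.58) (explicit in its proof, not numerical); the `R₀`-depth of `x` (`{|z − x| ≤ 2r_S + 2LᵏK₀(d+1)} ⊂ Ω`) and
«`Ω` a union of big blocks, `K₀ ∣ M`, `3LᵏK₀ ≤ |T_ε|_μ`, `Lᵏε ≤ ε₀`» are p17's hypotheses, print's «□ a sum of large blocks, x ∈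
Bᵏ(y), y at distance ≥ 2r from ∂□₁».  Deriving `λ = O(1)p(Lᵏε)` from (2.55)₃ and the smallness of `e^{−ρ/(4K₀)}`, `ρ ≈ 2r(Lᵏε)`,
is the assembly's business (brick F5), as is (2.68) (the passage `A^{(k)} → A₀`, over r14's `B3Op116SourceForm`).  (c) §3's
no-wrap hypothesis is stated primitively (`n_μ(ȳ − o) + Lᵏ ≤ |T_ε|_μ`); its discharge for print's `□` is F2's `window_of_kbox`.
(d) Nothing about (2.77) (derivatives) here.  Value = the two printed ingredients (2.75)/(2.76) of (2.65) now hold for the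
carrier of record's own `G^ε_k(□, 0)` and `φ^{(k)}`; NOT summit progress.
-/

open scoped BigOperators

noncomputable section

namespace Literature.MathematicalPhysics.QuantumFieldTheory.Balaban1983to89.B2Eq276HiggsRegion

open Literature.MathematicalPhysics.QuantumFieldTheory.Balaban1983to89.HiggsLattice
open Literature.MathematicalPhysics.QuantumFieldTheory.Balaban1983to89.HiggsAveraging
open Literature.MathematicalPhysics.QuantumFieldTheory.Balaban1983to89.HiggsCovariance
open Literature.MathematicalPhysics.QuantumFieldTheory.Balaban1983to89.HiggsCovariancePos
open Literature.MathematicalPhysics.QuantumFieldTheory.Balaban1983to89.HiggsGaugeInvariance (rot)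
open Literature.MathematicalPhysics.QuantumFieldTheory.Balaban1983to89.B2Eq255Concrete (bgScalar256 bgScalar256_eq cutTo
  cutTo_of_mem cutTo_of_not_mem underRegion mem_underRegion)
open Literature.MathematicalPhysics.QuantumFieldTheory.Balaban1983to89.B2Eq267HiggsRegion (bgScalar256_apply_eq_sum)
open Literature.MathematicalPhysics.QuantumFieldTheory.Balaban1983to89.B2Ineq258HiggsRegion (ineq258_GQ_higgs_region_coarse
  chi_smul_avgQkAdj_single)
open Literature.MathematicalPhysics.QuantumFieldTheory.Balaban1983to89.B2Ineq329ZeroAveraging (avgQk_zero_apply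
  multiContourSum_zero_field)
open Literature.MathematicalPhysics.QuantumFieldTheory.Balaban1983to89.B2Ineq329CovariantAveraging (norm_U_apply_sub_le)
open Literature.MathematicalPhysics.QuantumFieldTheory.Balaban1983to89.B2Ineq329PrismHolonomy (val_steps val_toFinest_blockIter
  sum_steps_le abs_multiContourSum_le blockIter_stair_src multiContourSum_sub)
open Literature.MathematicalPhysics.QuantumFieldTheory.Balaban1983to89.B2Restr216Lattice (norm_U_apply)
open Literature.MathematicalPhysics.QuantumFieldTheory.Balaban1983to89.B1Eq353SupNorm (card_blockK)
open Literature.MathematicalPhysics.QuantumFieldTheory.Balaban1983to89.B1Ineq234Concrete (tdist_self)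
open Literature.MathematicalPhysics.QuantumFieldTheory.Balaban1983to89.B1TorusRegionHSizes (IsBigBlockUnion)
open Literature.MathematicalPhysics.QuantumFieldTheory.Balaban1983to89.B1TorusCubeCover (half)
open Literature.MathematicalPhysics.QuantumFieldTheory.Balaban1983to89.B1TorusCubeLocality26 (rS)
open Literature.MathematicalPhysics.QuantumFieldTheory.Balaban1983to89.B1TorusRegionRop (chi)
open Literature.MathematicalPhysics.QuantumFieldTheory.Balaban1983to89.B2Eq230CondShiftBound (sum_exp_neg_tdist_le)
open Literature.MathematicalPhysics.QuantumFieldTheory.Balaban1983to89.B4Sect5Proof (latticeConst latticeConst_nonneg)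
open Literature.MathematicalPhysics.QuantumFieldTheory.Balaban1983to89.B2Eq273GaugeCovariance (constVec constVec_apply
  cornerGauge contourSum_constVec U_cornerGauge U_angle_eq U_add_apply)

variable {P : HiggsLattice.Params} {N : ℕ}

/-! ## §1 (2.75) EXACTLY: the zero-field Neumann operators of `Ω = Bᵏ(□₂)` on the cut constant `1_Ω v` -/

section Eq275

variable (C : ChargeData N) {k : ℕ}

/-- `Q_k^*(0)(1_{□₂}v) = 1_{Bᵏ(□₂)}v`: at `A = 0` the transports are `U(0) = 1` and `(Q_k^*ψ)(x) = ψ(x_k)` — print's «Q_k^*1»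
read on `□`. [cite: Balaban1982Higgs2, Lemma 2.4 proof (2.75) p.573] [cite: Balaban1982Higgs1, (2.20) p.610] -/
theorem avgQkAdj_zero_cutTo_const (sq : Finset (HiggsLattice.Site P k)) (v : EuclideanSpace ℝ (Fin N)) :
    avgQkAdj C (0 : HiggsLattice.VecField P 0) k (cutTo sq (fun _ => v))
      = cutTo (underRegion k sq) (fun _ => v) := by
  funext x
  have h : avgQkAdj C (0 : HiggsLattice.VecField P 0) k (cutTo sq (fun _ => v)) x
      = star (C.U (P.mesh 0) (multiContourSum (0 : HiggsLattice.VecField P 0) k x))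
          (cutTo sq (fun _ => v) (blockIter k x)) := rfl
  rw [h, multiContourSum_zero_field, ChargeData.U_zero, star_one, one_apply_eq_self]
  by_cases hx : blockIter k x ∈ sq
  · rw [cutTo_of_mem sq _ hx, cutTo_of_mem (underRegion k sq) _ ((mem_underRegion k sq x).2 hx)]
  · rw [cutTo_of_not_mem sq _ hx,
      cutTo_of_not_mem (underRegion k sq) _ (fun h' => hx ((mem_underRegion k sq x).1 h'))]

/-- `Q_k(0)(1_{Bᵏ(□₂)}v) = 1_{□₂}v` (`k ≤ K`): the plain block mean (`|Bᵏ(y)| = Lᵏᵈ`) of a field constant on `k`-blocks.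
[cite: Balaban1982Higgs2, Lemma 2.4 proof (2.75) p.573] [cite: Balaban1982Higgs1, (2.11) p.609] -/
theorem avgQkLin_zero_cutTo_const (hk : k ≤ P.K) (sq : Finset (HiggsLattice.Site P k)) (v : EuclideanSpace ℝ (Fin N)) :
    avgQkLin C (0 : HiggsLattice.VecField P 0) k (cutTo (underRegion k sq) (fun _ => v)) = cutTo sq (fun _ => v) := by
  funext y
  rw [avgQkLin_apply, avgQk_zero_apply]
  have hx : ∀ x ∈ blockK k y, cutTo (underRegion k sq) (fun _ => v) x = cutTo sq (fun _ => v) y := by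
    intro x hx
    rw [mem_blockK] at hx
    by_cases hy : y ∈ sq
    · have hxΩ : x ∈ underRegion k sq := by rw [mem_underRegion, hx]; exact hy
      rw [cutTo_of_mem sq _ hy, cutTo_of_mem (underRegion k sq) _ hxΩ]
    · have hxΩ : x ∉ underRegion k sq := by rw [mem_underRegion, hx]; exact hy
      rw [cutTo_of_not_mem sq _ hy, cutTo_of_not_mem (underRegion k sq) _ hxΩ]
  rw [Finset.sum_congr rfl hx, Finset.sum_const, card_blockK hk, ← Nat.cast_smul_eq_nsmul ℝ, smul_smul]
  have hL : (P.L : ℝ) ≠ 0 := (Nat.cast_pos.mpr P.hL).ne'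
  have h1 : ((P.L : ℝ) ^ (k * P.d))⁻¹ * ((P.L ^ (k * P.d) : ℕ) : ℝ) = 1 := by
    push_cast
    exact inv_mul_cancel₀ (pow_ne_zero _ hL)
  rw [h1, one_smul]

/-- `P_k(0)(1_{Bᵏ(□₂)}v) = 1_{Bᵏ(□₂)}v` (`k ≤ K`) — print's «a_kP_k□1 = a_k1» inside (2.75).
[cite: Balaban1982Higgs2, Lemma 2.4 proof (2.75) p.573] [cite: Balaban1982Higgs1, (2.20) p.610] -/
theorem projPk_zero_cutTo_const (hk : k ≤ P.K) (sq : Finset (HiggsLattice.Site P k)) (v : EuclideanSpace ℝ (Fin N)) :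
    projPk C (0 : HiggsLattice.VecField P 0) k (cutTo (underRegion k sq) (fun _ => v))
      = cutTo (underRegion k sq) (fun _ => v) := by
  rw [projPk, LinearMap.comp_apply, avgQkLin_zero_cutTo_const C hk, avgQkAdj_zero_cutTo_const]

/-- `−Δ^{ε,N}_{0,Ω}(1_Ω v) = 0` for EVERY region `Ω ⊂ T_ε`: a Neumann bond term is kept only when both endpoints lie in `Ω`,
where the field is the same `v` and `U(0) = 1` — print's «G_k(□,0)(−Δ^{η,N}_{0,□} + …)1» with `−Δ^{η,N}_{0,□}1 = 0`.
[cite: Balaban1982Higgs2, Lemma 2.4 proof (2.75) p.573] [cite: Balaban1982Higgs1, (2.17) p.610] -/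
theorem covLaplacianN_zero_cutTo_const (Ω : Finset (HiggsLattice.Site P 0)) (v : EuclideanSpace ℝ (Fin N)) :
    covLaplacianN C Ω (0 : HiggsLattice.VecField P 0) (cutTo Ω (fun _ => v)) = 0 := by
  funext x
  have happ : ∀ (B : HiggsLattice.VecField P 0) (g : HiggsLattice.ScalarField P 0 N), covLaplacianN C Ω B g x
      = ((P.mesh 0)⁻¹ ^ 2) • ∑ μ : Fin P.d, (fwdTerm C Ω B x μ g + bwdTerm C Ω B x μ g) := by
    intro B g
    simp only [covLaplacianN, LinearMap.pi_apply, LinearMap.smul_apply, LinearMap.coe_sum, Finset.sum_apply,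
      LinearMap.add_apply]
  have hfwd : ∀ (g : HiggsLattice.ScalarField P 0 N) (μ : Fin P.d), fwdTerm C Ω (0 : HiggsLattice.VecField P 0) x μ g
      = if x ∈ Ω ∧ x.shift μ ∈ Ω then g x - g (x.shift μ) else 0 := by
    intro g μ
    unfold fwdTerm
    split_ifs <;> simp [ChargeData.U_zero]
  have hbwd : ∀ (g : HiggsLattice.ScalarField P 0 N) (μ : Fin P.d), bwdTerm C Ω (0 : HiggsLattice.VecField P 0) x μ g
      = if x ∈ Ω ∧ x.unshift μ ∈ Ω then g x - g (x.unshift μ) else 0 := by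
    intro g μ
    unfold bwdTerm
    split_ifs <;> simp [ChargeData.U_zero]
  rw [happ, Pi.zero_apply]
  refine smul_eq_zero_of_right _ (Finset.sum_eq_zero fun μ _ => ?_)
  rw [hfwd, hbwd]
  have e1 : (if x ∈ Ω ∧ x.shift μ ∈ Ω then cutTo Ω (fun _ => v) x - cutTo Ω (fun _ => v) (x.shift μ) else 0) = 0 := by
    split_ifs with h
    · rw [cutTo_of_mem Ω _ h.1, cutTo_of_mem Ω _ h.2, sub_self]
    · rfl
  have e2 : (if x ∈ Ω ∧ x.unshift μ ∈ Ω then cutTo Ω (fun _ => v) x - cutTo Ω (fun _ => v) (x.unshift μ) else 0) = 0 := by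
    split_ifs with h
    · rw [cutTo_of_mem Ω _ h.1, cutTo_of_mem Ω _ h.2, sub_self]
    · rfl
  rw [e1, e2, add_zero]

/-- **`H_k(Ω, 0)(1_Ω v) = (m² + a_kℓ⁻²)·1_Ω v`** for `Ω = Bᵏ(□₂)`, `k ≤ K` (`ℓ = Lᵏε`): print's «(−Δ^{η,N}_{0,□} + m²(Lᵏε)² + a_kP_k□)1 =
(m²(Lᵏε)² + a_k)1» of (2.75)/(2.62), region version of `B2Lemma23HiggsLattice.covOpK_zeroField_const`.
[cite: Balaban1982Higgs2, Lemma 2.4 proof (2.75) p.573] [cite: Balaban1982Higgs2, Lemma 2.3 proof (2.62) p.571] -/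
theorem covOpK_zero_cutTo_const (hk : k ≤ P.K) (sq : Finset (HiggsLattice.Site P k)) (msq a : ℝ)
    (v : EuclideanSpace ℝ (Fin N)) :
    covOpK C (underRegion k sq) (0 : HiggsLattice.VecField P 0) msq a k (cutTo (underRegion k sq) (fun _ => v))
      = (msq + B1.aSeq a P.L k * ((P.mesh k)⁻¹ ^ 2)) • cutTo (underRegion k sq) (fun _ => v) := by
  simp only [covOpK, LinearMap.add_apply, LinearMap.smul_apply, LinearMap.id_apply, covLaplacianN_zero_cutTo_const,
    projPk_zero_cutTo_const C hk, zero_add, add_smul]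

/-- **`G^ε_k(Ω, 0)(1_Ω v) = (m² + a_kℓ⁻²)⁻¹·1_Ω v`** (`m² > 0`, `a_k ≥ 0`, `k ≤ K`) — (2.75) solved for «G_k(□, 0)Q_k^*1», as
(2.62) «G_kQ_k^*1 = 1/(a_k + m²(Lᵏε)²)». [cite: Balaban1982Higgs2, Lemma 2.4 proof (2.75) p.573]
[cite: Balaban1982Higgs2, Lemma 2.3 proof (2.62) p.571] -/
theorem propagatorK_zero_cutTo_const (hk : k ≤ P.K) {msq : ℝ} (hmsq : 0 < msq) {a : ℝ} (hak : 0 ≤ B1.aSeq a P.L k)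
    (sq : Finset (HiggsLattice.Site P k)) (v : EuclideanSpace ℝ (Fin N)) :
    propagatorK C (underRegion k sq) (0 : HiggsLattice.VecField P 0) msq a k (cutTo (underRegion k sq) (fun _ => v))
      = (msq + B1.aSeq a P.L k * ((P.mesh k)⁻¹ ^ 2))⁻¹ • cutTo (underRegion k sq) (fun _ => v) := by
  set c : ℝ := msq + B1.aSeq a P.L k * ((P.mesh k)⁻¹ ^ 2) with hc_def
  have hc : 0 < c := by rw [hc_def]; positivity
  have h1 : covOpK C (underRegion k sq) (0 : HiggsLattice.VecField P 0) msq a k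
      (c⁻¹ • cutTo (underRegion k sq) (fun _ => v)) = cutTo (underRegion k sq) (fun _ => v) := by
    rw [map_smul, covOpK_zero_cutTo_const C hk, ← hc_def, smul_smul, inv_mul_cancel₀ hc.ne', one_smul]
  conv_lhs => rw [← h1]
  rw [propagatorK_covOpK_apply C (underRegion k sq) 0 hmsq a k hak]

/-- **(2.75), THE DISPLAY**: «a_kG_k(□, 0)Q_k^*1 = G_k(□, 0)(−Δ^{η,N}_{0,□} + m²(Lᵏε)² + a_kP_k□)1 − m²(Lᵏε)²G_k(□, 0)Q_k^*1 = 1 −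
m²(Lᵏε)²G_k(□, 0)Q_k^*1» — on the carrier (ε-currency): `a_kℓ⁻²G^ε_k(Ω,0)w = w − m²G^ε_k(Ω,0)w`, `w = 1_Ω v = Q_k^*(0)(1_{□₂}v)`.
[cite: Balaban1982Higgs2, Lemma 2.4 proof (2.75) p.573] -/
theorem eq275_printed (hk : k ≤ P.K) {msq : ℝ} (hmsq : 0 < msq) {a : ℝ} (hak : 0 ≤ B1.aSeq a P.L k)
    (sq : Finset (HiggsLattice.Site P k)) (v : EuclideanSpace ℝ (Fin N)) :
    (B1.aSeq a P.L k * ((P.mesh k)⁻¹ ^ 2)) •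
        propagatorK C (underRegion k sq) (0 : HiggsLattice.VecField P 0) msq a k (cutTo (underRegion k sq) (fun _ => v))
      = cutTo (underRegion k sq) (fun _ => v)
          - msq • propagatorK C (underRegion k sq) (0 : HiggsLattice.VecField P 0) msq a k
              (cutTo (underRegion k sq) (fun _ => v)) := by
  rw [propagatorK_zero_cutTo_const C hk hmsq hak, smul_smul, smul_smul, eq_sub_iff_add_eq, ← add_smul]
  have hc : 0 < msq + B1.aSeq a P.L k * ((P.mesh k)⁻¹ ^ 2) := by positivity
  rw [add_comm (B1.aSeq a P.L k * ((P.mesh k)⁻¹ ^ 2) * _), ← add_mul, mul_inv_cancel₀ hc.ne', one_smul]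

/-- **(2.75) FOR THE TYPER'S (2.56)**: `a_kG_k(□, 0)Q_k^*(□₂·v) = (a_k/(a_k + m²(Lᵏε)²))·1_{Bᵏ(□₂)}v` — the background field (2.56) of
the CONSTANT unit-lattice field `v` on `□₁ = □₂` at zero vector field is the constant `a_k/(a_k + m²ℓ²)` of (2.62)–(2.63) on `□`
(`m² > 0`, `a_k ≥ 0`, `k ≤ K`). [cite: Balaban1982Higgs2, Lemma 2.4 proof (2.75) p.573] [cite: Balaban1982Higgs2, (2.56) p.570]
[cite: Balaban1982Higgs2, Lemma 2.3 proof (2.62)–(2.63) p.571] -/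
theorem eq275_region (hk : k ≤ P.K) {msq : ℝ} (hmsq : 0 < msq) {a : ℝ} (hak : 0 ≤ B1.aSeq a P.L k)
    (sq : Finset (HiggsLattice.Site P k)) (v : EuclideanSpace ℝ (Fin N)) :
    bgScalar256 C msq a k sq sq (0 : HiggsLattice.VecField P 0) (fun _ => v)
      = (B1.aSeq a P.L k / (B1.aSeq a P.L k + msq * P.mesh k ^ 2)) • cutTo (underRegion k sq) (fun _ => v) := by
  rw [bgScalar256_eq, avgQkAdj_zero_cutTo_const, propagatorK_zero_cutTo_const C hk hmsq hak, smul_smul]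
  congr 1
  have hℓ : 0 < P.mesh k := P.mesh_pos k
  have hc : 0 < B1.aSeq a P.L k + msq * P.mesh k ^ 2 := by positivity
  field_simp
  ring

/-- (2.75) at a point `x ∈ Bᵏ(□₂)`: `(a_kG_k(□, 0)Q_k^*(□₂·v))(x) = (a_k/(a_k + m²(Lᵏε)²))·v`.
[cite: Balaban1982Higgs2, Lemma 2.4 proof (2.75) p.573] -/
theorem eq275_region_apply (hk : k ≤ P.K) {msq : ℝ} (hmsq : 0 < msq) {a : ℝ} (hak : 0 ≤ B1.aSeq a P.L k)
    (sq : Finset (HiggsLattice.Site P k)) (v : EuclideanSpace ℝ (Fin N)) {x : HiggsLattice.Site P 0}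
    (hx : blockIter k x ∈ sq) :
    bgScalar256 C msq a k sq sq (0 : HiggsLattice.VecField P 0) (fun _ => v) x
      = (B1.aSeq a P.L k / (B1.aSeq a P.L k + msq * P.mesh k ^ 2)) • v := by
  rw [eq275_region C hk hmsq hak, Pi.smul_apply, cutTo_of_mem (underRegion k sq) _ ((mem_underRegion k sq x).2 hx)]

end Eq275

/-! ## §2 (2.76) AT THE ZERO FIELD: `(a_kG_k(□,0)Q_k^*□₁φ′)(x) = (a_k/(a_k + m²ℓ²))φ′(ȳ) + O(λ) + O(e^{−ρ/(4K₀)}|φ′(ȳ)|)` -/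

section Eq276

/-- two sums against one summable weight: `‖u′ − u‖ ≤ αe` on `S`, `‖u‖ ≤ βe` on `T ∖ S`, `e ≥ 0`, `Σ_T e ≤ K` give
`‖Σ_T u − Σ_S u′‖ ≤ (α + β)K`. [folklore] -/
private theorem norm_sum_sub_sum_le' {ι E : Type*} [SeminormedAddCommGroup E] [DecidableEq ι] (S T : Finset ι)
    (hST : S ⊆ T) (u u' : ι → E) (e : ι → ℝ) (he : ∀ y, 0 ≤ e y) {α β K : ℝ} (hα : 0 ≤ α) (hβ : 0 ≤ β)
    (h1 : ∀ y ∈ S, ‖u' y - u y‖ ≤ α * e y) (h2 : ∀ y ∈ T \ S, ‖u y‖ ≤ β * e y) (hK : ∑ y ∈ T, e y ≤ K) :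
    ‖∑ y ∈ T, u y - ∑ y ∈ S, u' y‖ ≤ (α + β) * K := by
  have hsplit : ∑ y ∈ T, u y - ∑ y ∈ S, u' y = ∑ y ∈ T \ S, u y + ∑ y ∈ S, (u y - u' y) := by
    rw [← Finset.sum_sdiff hST, Finset.sum_sub_distrib]
    abel
  have hS : ∑ y ∈ S, e y ≤ K :=
    (Finset.sum_le_sum_of_subset_of_nonneg hST fun y _ _ => he y).trans hK
  have hTS : ∑ y ∈ T \ S, e y ≤ K :=
    (Finset.sum_le_sum_of_subset_of_nonneg Finset.sdiff_subset fun y _ _ => he y).trans hK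
  rw [hsplit]
  calc ‖∑ y ∈ T \ S, u y + ∑ y ∈ S, (u y - u' y)‖
      ≤ ∑ y ∈ T \ S, ‖u y‖ + ∑ y ∈ S, ‖u y - u' y‖ :=
        (norm_add_le _ _).trans (add_le_add (norm_sum_le _ _) (norm_sum_le _ _))
    _ ≤ ∑ y ∈ T \ S, β * e y + ∑ y ∈ S, α * e y := by
        refine add_le_add (Finset.sum_le_sum fun y hy => h2 y hy) (Finset.sum_le_sum fun y hy => ?_)
        rw [norm_sub_rev]
        exact h1 y hy
    _ = β * ∑ y ∈ T \ S, e y + α * ∑ y ∈ S, e y := by rw [Finset.mul_sum, Finset.mul_sum]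
    _ ≤ β * K + α * K := add_le_add (mul_le_mul_of_nonneg_left hTS hβ) (mul_le_mul_of_nonneg_left hS hα)
    _ = (α + β) * K := by ring

/-- the tail exponent: `e^{−τ/(2K₀)} ≤ e^{−ρ/(4K₀)}·e^{−τ/(4K₀)}` for `τ ≥ ρ`. [folklore] -/
private theorem exp_tail_le' (K₀ : ℕ) {ρ τ : ℝ} (h : ρ ≤ τ) :
    Real.exp (-(1 / (2 * K₀) * τ)) ≤ Real.exp (-(1 / (4 * K₀) * ρ)) * Real.exp (-(1 / (4 * K₀) * τ)) := by
  rw [← Real.exp_add]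
  refine Real.exp_le_exp.2 ?_
  have hδ : (0 : ℝ) ≤ 1 / (4 * K₀) := by positivity
  have h2 : (1 : ℝ) / (2 * K₀) = 2 * (1 / (4 * K₀)) := by ring
  rw [h2]
  nlinarith [mul_le_mul_of_nonneg_left h hδ]

/-- the Lipschitz exponent: `τe^{−τ/(2K₀)} ≤ 4K₀e^{−τ/(4K₀)}` for `τ ≥ 0`, `K₀ ≥ 1` (`se^{−s} ≤ 1`). [folklore] -/
private theorem mul_exp_le' {K₀ : ℕ} (hK₀ : 1 ≤ K₀) {τ : ℝ} (hτ : 0 ≤ τ) :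
    τ * Real.exp (-(1 / (2 * K₀) * τ)) ≤ 4 * K₀ * Real.exp (-(1 / (4 * K₀) * τ)) := by
  have hK : (0 : ℝ) < K₀ := by exact_mod_cast hK₀
  have h4 : (0 : ℝ) < 4 * K₀ := by positivity
  set s : ℝ := 1 / (4 * K₀) * τ with hs
  have hs0 : 0 ≤ s := by positivity
  have hτs : τ = 4 * K₀ * s := by rw [hs]; field_simp
  have h2 : -(1 / (2 * (K₀ : ℝ)) * τ) = -s + -s := by rw [hs]; ring
  rw [h2, Real.exp_add, hτs]
  have hse : s * Real.exp (-s) ≤ 1 := by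
    rw [Real.exp_neg]
    have hexp : 0 < Real.exp s := Real.exp_pos s
    rw [mul_inv_le_iff₀ hexp, one_mul]
    linarith [Real.add_one_le_exp s]
  have hes : 0 ≤ Real.exp (-s) := Real.exp_nonneg _
  calc 4 * K₀ * s * (Real.exp (-s) * Real.exp (-s)) = 4 * K₀ * Real.exp (-s) * (s * Real.exp (-s)) := by ring
    _ ≤ 4 * K₀ * Real.exp (-s) * 1 := mul_le_mul_of_nonneg_left hse (by positivity)
    _ = 4 * K₀ * Real.exp (-s) := mul_one _

/-- **(2.76) AT THE ZERO FIELD, ON THE (Higgs)₂,₃ CARRIER** (ε-lattice currency).  For `d ≥ 1`, `L ≥ 2`, `a, m² > 0`, `N`, charge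
data and a mesh cap `ε₀`: there are `K₀min` and, for every cube size `K₀ ≥ K₀min`, a constant `C₁ ≥ 0` such that on every torus
of the carrier with `K₀ ∣ M`, at every level `1 ≤ k ≤ K_P` with `3LᵏK₀ ≤ |T_ε|_μ` and `Lᵏε ≤ ε₀`, for all `□₁ ⊆ □₂ ⊂ T^{(k)}` with
`□ = Bᵏ(□₂)` a big-block union, every point `x` with `{|z − x| ≤ 2r_S + 2LᵏK₀(d+1)} ⊂ □` (`ȳ = x_k`), every unit-lattice field `φ′`
with `|φ′(y′) − φ′(ȳ)| ≤ λ|ȳ − y′|` on `□₁` (`λ ≥ 0`, distance (1.3) of `T^{(k)}`) and every `ρ ≤ |ȳ − y′|` for all `y′ ∈ □₂ ∖ □₁`: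
`‖(a_kG_k(□, 0)Q_k^*□₁φ′)(x) − (a_k/(a_k + m²(Lᵏε)²))φ′(ȳ)‖ ≤ a_k·C₁·(4K₀λ + e^{−ρ/(4K₀)}|φ′(ȳ)|)`, the field being the typer's
(2.56) `bgScalar256 … □₂ □₁ 0 φ′` and `C₁ = c₀e^{1/(2K₀)}K_d(1/(4K₀))` with p17's (2.58) constant `c₀`.
[cite: Balaban1982Higgs2, Lemma 2.4 proof (2.76) p.573 «so the same conclusion holds and we get (a_kG_k(□, 0)Q_k^*□₁φ′)(x) = φ′(y) + O(p(Lᵏε)), x ∈ Bᵏ(y)»]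
[cite: Balaban1982Higgs2, Prop. 2.2 (2.58) pp.570–571] [cite: Balaban1982Higgs2, Lemma 2.3 proof (2.62)–(2.64) pp.571–572] -/
theorem eq276_zero_region (d L : ℕ) (hd : 1 ≤ d) (hL : 2 ≤ L) {a : ℝ} (ha : 0 < a) {msq : ℝ} (hmsq : 0 < msq)
    (N : ℕ) (C : ChargeData N) (ε₀ : ℝ) :
    ∃ K₀min : ℕ, ∀ K₀ : ℕ, K₀min ≤ K₀ → ∃ C₁ : ℝ, 0 ≤ C₁ ∧
      ∀ (P : HiggsLattice.Params), P.d = d → P.L = L → K₀ ∣ P.M →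
      ∀ {k : ℕ}, 1 ≤ k → k ≤ P.K → (∀ μ, 3 * half P k K₀ ≤ P.sitesPerDir 0 μ) → P.mesh k ≤ ε₀ →
      ∀ (sq₂ sq₁ : Finset (HiggsLattice.Site P k)), sq₁ ⊆ sq₂ → IsBigBlockUnion k K₀ (underRegion k sq₂) →
      ∀ (x : HiggsLattice.Site P 0),
        (∀ z, HiggsLattice.Site.tdist x z ≤ 2 * rS P k K₀ + 2 * half P k K₀ * (P.d + 1) → z ∈ underRegion k sq₂) →
      ∀ (φ : HiggsLattice.ScalarField P k N) (lam : ℝ), 0 ≤ lam →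
        (∀ y ∈ sq₁, ‖φ y - φ (blockIter k x)‖ ≤ lam * (HiggsLattice.Site.tdist (blockIter k x) y : ℝ)) →
      ∀ (ρ : ℝ), (∀ y ∈ sq₂, y ∉ sq₁ → ρ ≤ (HiggsLattice.Site.tdist (blockIter k x) y : ℝ)) →
        ‖bgScalar256 C msq a k sq₂ sq₁ (0 : HiggsLattice.VecField P 0) φ x
            - (B1.aSeq a P.L k / (B1.aSeq a P.L k + msq * P.mesh k ^ 2)) • φ (blockIter k x)‖
          ≤ B1.aSeq a P.L k * C₁ *
              (4 * K₀ * lam + Real.exp (-(1 / (4 * K₀) * ρ)) * ‖φ (blockIter k x)‖) := by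
  obtain ⟨c₀, hc₀, K₁, hV⟩ := ineq258_GQ_higgs_region_coarse d L hd hL ha hmsq N C ε₀ 0 1 le_rfl one_pos
  refine ⟨max K₁ 1, fun K₀ hK₀ => ?_⟩
  have hK₁ : K₁ ≤ K₀ := (le_max_left _ _).trans hK₀
  have hK₀1 : 1 ≤ K₀ := (le_max_right _ _).trans hK₀
  obtain ⟨e₁, he₁, hV1⟩ := hV K₀ hK₁
  have hδpos : (0 : ℝ) < 1 / (4 * K₀) := by
    have : (0 : ℝ) < K₀ := by exact_mod_cast hK₀1
    positivity
  set Kd : ℝ := latticeConst d (1 / (4 * K₀)) with hKd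
  have hKd0 : 0 ≤ Kd := latticeConst_nonneg d hδpos.le
  refine ⟨c₀ * Real.exp (1 / (2 * K₀)) * Kd, by positivity, ?_⟩
  intro P hPd hPL hK₀M k hk1 hk hsz hε sq₂ sq₁ h12 hΩ x hx φ lam hlam hlip ρ hρ
  set Ω := underRegion k sq₂ with hΩdef
  have hak : 0 ≤ B1.aSeq a P.L k := by
    have hL1 : (1 : ℝ) < P.L := by rw [hPL]; exact_mod_cast hL
    exact (B1.aSeq_pos ha hL1 hk1).le
  -- `A = 0` is (I.2.23)-regular on `Ω` with constant `0`
  have hreg : ∀ z ∈ Ω, ∀ μ ν : Fin P.d,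
      P.mesh k * |C.e| / e₁ * |(0 : HiggsLattice.VecField P 0) ⟨z.shift μ, ν⟩ - (0 : HiggsLattice.VecField P 0) ⟨z, ν⟩|
        ≤ 0 * e₁ ^ ((1 : ℝ) - 1) / (P.L : ℝ) ^ k := by
    intro z _ μ ν
    simp
  -- `x ∈ Ω`, so `ȳ = x_k ∈ □₂`
  have hxΩ : x ∈ Ω := hx x (by rw [tdist_self]; positivity)
  have hxsq : blockIter k x ∈ sq₂ := (mem_underRegion k sq₂ x).1 hxΩ
  -- the two families of one-block terms and the weight
  set u : HiggsLattice.Site P k → EuclideanSpace ℝ (Fin N) := fun y =>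
    propagatorK C Ω (0 : HiggsLattice.VecField P 0) msq a k
      (avgQkAdj C (0 : HiggsLattice.VecField P 0) k (Pi.single y (φ (blockIter k x)))) x with hudef
  set u' : HiggsLattice.Site P k → EuclideanSpace ℝ (Fin N) := fun y =>
    propagatorK C Ω (0 : HiggsLattice.VecField P 0) msq a k
      (avgQkAdj C (0 : HiggsLattice.VecField P 0) k (Pi.single y (φ y))) x with hu'def
  set e : HiggsLattice.Site P k → ℝ := fun y =>
    Real.exp (-(1 / (4 * K₀) * (HiggsLattice.Site.tdist (blockIter k x) y : ℝ))) with hedef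
  have he : ∀ y, 0 ≤ e y := fun y => Real.exp_nonneg _
  -- Prop. 2.2 (2.58) at `A = 0` for the one-block sources, `y′ ∈ □₂`
  have hker : ∀ y ∈ sq₂, ∀ v : EuclideanSpace ℝ (Fin N),
      ‖propagatorK C Ω (0 : HiggsLattice.VecField P 0) msq a k
          (avgQkAdj C (0 : HiggsLattice.VecField P 0) k (Pi.single y v)) x‖
        ≤ (c₀ * Real.exp (1 / (2 * K₀))) * P.mesh k ^ 2 *
            Real.exp (-(1 / (2 * K₀) * (HiggsLattice.Site.tdist (blockIter k x) y : ℝ))) * ‖v‖ := by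
    intro y hy v
    have hyΩ : ∀ z : HiggsLattice.Site P 0, blockIter k z = y → z ∈ Ω := by
      intro z hz
      rw [hΩdef, mem_underRegion, hz]
      exact hy
    have h := hV1 P hPd hPL hK₀M hk1 hk hsz hε Ω hΩ (0 : HiggsLattice.VecField P 0) he₁ le_rfl hreg x hx y v
    rwa [chi_smul_avgQkAdj_single C (0 : HiggsLattice.VecField P 0) k Ω y v hyΩ] at h
  set α : ℝ := c₀ * Real.exp (1 / (2 * K₀)) * P.mesh k ^ 2 * (4 * K₀ * lam) with hαdef
  set β' : ℝ := c₀ * Real.exp (1 / (2 * K₀)) * P.mesh k ^ 2 *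
    (Real.exp (-(1 / (4 * K₀) * ρ)) * ‖φ (blockIter k x)‖) with hβdef
  have hα : 0 ≤ α := by positivity
  have hβ' : 0 ≤ β' := by positivity
  -- (i) `y′ ∈ □₁`: the Lipschitz terms
  have h1 : ∀ y ∈ sq₁, ‖u' y - u y‖ ≤ α * e y := by
    intro y hy
    have hdiff : u' y - u y = propagatorK C Ω (0 : HiggsLattice.VecField P 0) msq a k
        (avgQkAdj C (0 : HiggsLattice.VecField P 0) k (Pi.single y (φ y - φ (blockIter k x)))) x := by
      rw [hu'def, hudef]
      simp only
      rw [Pi.single_sub, map_sub, map_sub, Pi.sub_apply]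
    have hb := hker y (h12 hy) (φ y - φ (blockIter k x))
    have hm2 : 0 ≤ c₀ * Real.exp (1 / (2 * K₀)) * P.mesh k ^ 2 := by positivity
    have hτ : 0 ≤ (HiggsLattice.Site.tdist (blockIter k x) y : ℝ) := Nat.cast_nonneg _
    have hle := mul_exp_le' hK₀1 hτ
    rw [hdiff]
    calc ‖propagatorK C Ω (0 : HiggsLattice.VecField P 0) msq a k
            (avgQkAdj C (0 : HiggsLattice.VecField P 0) k (Pi.single y (φ y - φ (blockIter k x)))) x‖
        ≤ (c₀ * Real.exp (1 / (2 * K₀))) * P.mesh k ^ 2 *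
            Real.exp (-(1 / (2 * K₀) * (HiggsLattice.Site.tdist (blockIter k x) y : ℝ))) *
              ‖φ y - φ (blockIter k x)‖ := hb
      _ ≤ (c₀ * Real.exp (1 / (2 * K₀))) * P.mesh k ^ 2 *
            Real.exp (-(1 / (2 * K₀) * (HiggsLattice.Site.tdist (blockIter k x) y : ℝ))) *
              (lam * (HiggsLattice.Site.tdist (blockIter k x) y : ℝ)) :=
          mul_le_mul_of_nonneg_left (hlip y hy) (by positivity)
      _ = (c₀ * Real.exp (1 / (2 * K₀))) * P.mesh k ^ 2 * lam *
            ((HiggsLattice.Site.tdist (blockIter k x) y : ℝ) *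
              Real.exp (-(1 / (2 * K₀) * (HiggsLattice.Site.tdist (blockIter k x) y : ℝ)))) := by ring
      _ ≤ (c₀ * Real.exp (1 / (2 * K₀))) * P.mesh k ^ 2 * lam * (4 * K₀ * e y) :=
          mul_le_mul_of_nonneg_left hle (by positivity)
      _ = α * e y := by rw [hαdef]; ring
  -- (ii) `y′ ∈ □₂ ∖ □₁`: the tail terms
  have h2 : ∀ y ∈ sq₂ \ sq₁, ‖u y‖ ≤ β' * e y := by
    intro y hy
    rw [Finset.mem_sdiff] at hy
    have hb := hker y hy.1 (φ (blockIter k x))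
    have htail := exp_tail_le' K₀ (hρ y hy.1 hy.2)
    have hm2 : 0 ≤ c₀ * Real.exp (1 / (2 * K₀)) * P.mesh k ^ 2 := by positivity
    calc ‖u y‖
        ≤ (c₀ * Real.exp (1 / (2 * K₀))) * P.mesh k ^ 2 *
            Real.exp (-(1 / (2 * K₀) * (HiggsLattice.Site.tdist (blockIter k x) y : ℝ))) * ‖φ (blockIter k x)‖ := hb
      _ ≤ (c₀ * Real.exp (1 / (2 * K₀))) * P.mesh k ^ 2 *
            (Real.exp (-(1 / (4 * K₀) * ρ)) * e y) * ‖φ (blockIter k x)‖ :=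
          mul_le_mul_of_nonneg_right (mul_le_mul_of_nonneg_left htail hm2) (norm_nonneg _)
      _ = β' * e y := by rw [hβdef]; ring
  -- (iii) the lattice sum
  have hsum : ∑ y ∈ sq₂, e y ≤ Kd := by
    have h := sum_exp_neg_tdist_le (P := P) (k := k) hδpos (blockIter k x)
    rw [hPd] at h
    exact (Finset.sum_le_sum_of_subset_of_nonneg (Finset.subset_univ sq₂) fun y _ _ => he y).trans h
  -- (iv) the two fields as sums, and the assembly
  have hmain := norm_sum_sub_sum_le' sq₁ sq₂ h12 u u' e he hα hβ' h1 h2 hsum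
  have hφ' : bgScalar256 C msq a k sq₂ sq₁ (0 : HiggsLattice.VecField P 0) φ x
      = (B1.aSeq a P.L k * (P.mesh k ^ 2)⁻¹) • ∑ y ∈ sq₁, u' y := by
    rw [bgScalar256_apply_eq_sum]
  have hconst : (B1.aSeq a P.L k / (B1.aSeq a P.L k + msq * P.mesh k ^ 2)) • φ (blockIter k x)
      = (B1.aSeq a P.L k * (P.mesh k ^ 2)⁻¹) • ∑ y ∈ sq₂, u y := by
    rw [← eq275_region_apply C hk hmsq hak sq₂ (φ (blockIter k x)) hxsq, bgScalar256_apply_eq_sum]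
  have hmesh : 0 < P.mesh k := P.mesh_pos k
  have hcoef : 0 ≤ B1.aSeq a P.L k * (P.mesh k ^ 2)⁻¹ := mul_nonneg hak (inv_nonneg.2 (sq_nonneg _))
  rw [hφ', hconst, ← smul_sub, norm_smul, Real.norm_eq_abs, abs_of_nonneg hcoef, norm_sub_rev]
  calc B1.aSeq a P.L k * (P.mesh k ^ 2)⁻¹ * ‖∑ y ∈ sq₂, u y - ∑ y ∈ sq₁, u' y‖
      ≤ B1.aSeq a P.L k * (P.mesh k ^ 2)⁻¹ * ((α + β') * Kd) := mul_le_mul_of_nonneg_left hmain hcoef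
    _ = B1.aSeq a P.L k * (c₀ * Real.exp (1 / (2 * K₀)) * Kd) *
          (4 * K₀ * lam + Real.exp (-(1 / (4 * K₀) * ρ)) * ‖φ (blockIter k x)‖) := by
        rw [hαdef, hβdef]
        field_simp

/-- from the constant of (2.75) to print's «φ′(y)» in (2.76): `‖f − v‖ ≤ ‖f − (a_k/(a_k+m²ℓ²))v‖ + (m²ℓ²/(a_k+m²ℓ²))‖v‖`
(«1 − m²(Lᵏε)²/(a_k + m²(Lᵏε)²)» of (2.63); `a_k ≥ 0`, `m²ℓ² > 0`). [cite: Balaban1982Higgs2, Lemma 2.4 proof (2.76) p.573]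
[cite: Balaban1982Higgs2, Lemma 2.3 proof (2.63) p.571] -/
theorem norm_sub_le_of_sub_kappa {E : Type*} [SeminormedAddCommGroup E] [NormedSpace ℝ E] {ak m : ℝ} (hak : 0 ≤ ak)
    (hm : 0 < m) (f v : E) :
    ‖f - v‖ ≤ ‖f - (ak / (ak + m)) • v‖ + m / (ak + m) * ‖v‖ := by
  have hpos : 0 < ak + m := by positivity
  have hone : ak / (ak + m) + m / (ak + m) = 1 := by
    field_simp
  have hsplit : f - v = (f - (ak / (ak + m)) • v) - (m / (ak + m)) • v := by
    rw [sub_sub, ← add_smul, hone, one_smul]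
  rw [hsplit]
  calc ‖(f - (ak / (ak + m)) • v) - (m / (ak + m)) • v‖
      ≤ ‖f - (ak / (ak + m)) • v‖ + ‖(m / (ak + m)) • v‖ := norm_sub_le _ _
    _ = ‖f - (ak / (ak + m)) • v‖ + m / (ak + m) * ‖v‖ := by
        rw [norm_smul, Real.norm_eq_abs, abs_of_nonneg (div_nonneg hm.le hpos.le)]

end Eq276

/-! ## §3 TRANSPORTERS of the constant field along `Γ^{(k)}_{ȳ,x}`, and `Q_k^*(A)` versus `Q_k^*(A₀)` -/

section Transport

variable {k : ℕ}

/-- the corner labels decrease with the level: `Lᵏ⌊v/Lᵏ⌋ ≤ Lⁱ⌊v/Lⁱ⌋` for `i ≤ k`. [folklore] -/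
private theorem cl_mono' {i k : ℕ} (hik : i ≤ k) (v : ℕ) : v / P.L ^ k * P.L ^ k ≤ v / P.L ^ i * P.L ^ i := by
  have hdvd : P.L ^ i ∣ v / P.L ^ k * P.L ^ k := Dvd.dvd.mul_left (pow_dvd_pow P.L hik) _
  calc v / P.L ^ k * P.L ^ k = (v / P.L ^ k * P.L ^ k) / P.L ^ i * P.L ^ i := (Nat.div_mul_cancel hdvd).symm
    _ ≤ v / P.L ^ i * P.L ^ i := Nat.mul_le_mul_right _ (Nat.div_le_div_right (Nat.div_mul_le_self v _))

/-- **`A₀(Γ^{(k)}_{ȳ,x}) = Σ_μ (x_μ − ȳ_μ)·c_μ`** for the constant field `A₀ = constVec c` (`k ≤ K`, `ȳ = x_k` read in `T_ε`): the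
composite contour (I.2.2) makes `x_μ − ȳ_μ ∈ [0, Lᵏ)` forward steps in direction `μ` altogether (telescoping of the block corners).
[cite: Balaban1982Higgs1, (2.2)–(2.3) p.608] [cite: Balaban1982Higgs2, Lemma 2.4 proof p.572 «a constant configuration A₀»] -/
theorem multiContourSum_constVec (hk : k ≤ P.K) (c : Fin P.d → ℝ) (x : HiggsLattice.Site P 0) :
    multiContourSum (constVec c) k x
      = ∑ μ : Fin P.d, ((x μ - toFinest (blockIter k x) μ).val : ℝ) * c μ := by
  unfold multiContourSum
  simp_rw [contourSum_constVec]
  rw [Finset.sum_comm]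
  refine Finset.sum_congr rfl fun μ _ => ?_
  rw [← Finset.sum_mul]
  congr 1
  have e : ∀ i ∈ Finset.range k, (((toFinest (blockIter i x)) μ - (toFinest (blockIter (i + 1) x)) μ).val : ℝ)
      = ((x μ).val / P.L ^ i * P.L ^ i : ℕ) - ((x μ).val / P.L ^ (i + 1) * P.L ^ (i + 1) : ℕ) := by
    intro i hi
    have hi1 : i + 1 ≤ P.K := by have := Finset.mem_range.1 hi; omega
    rw [val_steps hi1, Nat.cast_sub (cl_mono' (Nat.le_succ i) _)]
  rw [Finset.sum_congr rfl e, Finset.sum_range_sub' (fun i => (((x μ).val / P.L ^ i * P.L ^ i : ℕ) : ℝ))]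
  simp only [pow_zero, Nat.div_one, mul_one]
  have hy : ((toFinest (blockIter k x)) μ).val ≤ (x μ).val := by
    rw [val_toFinest_blockIter hk]
    exact Nat.div_mul_le_self _ _
  rw [ZMod.val_sub hy, Nat.cast_sub hy, val_toFinest_blockIter hk]

/-- the number of forward steps of `Γ^{(k)}_{ȳ,x}` in direction `μ` is `< Lᵏ` (`k ≤ K`). [cite: Balaban1982Higgs1, (2.2) p.608] -/
theorem val_sub_toFinest_blockIter_lt (hk : k ≤ P.K) (x : HiggsLattice.Site P 0) (μ : Fin P.d) :
    (x μ - toFinest (blockIter k x) μ).val < P.L ^ k := by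
  have hy : ((toFinest (blockIter k x)) μ).val ≤ (x μ).val := by
    rw [val_toFinest_blockIter hk]
    exact Nat.div_mul_le_self _ _
  rw [ZMod.val_sub hy, val_toFinest_blockIter hk]
  have hLk : 0 < P.L ^ k := pow_pos P.hL k
  have h := Nat.mod_add_div' (x μ).val (P.L ^ k)
  have hlt := Nat.mod_lt (x μ).val hLk
  omega

/-- **`A₀(Γ_{o,x}) − A₀(Γ_{o,ȳ}) = A₀(Γ^{(k)}_{ȳ,x})`** for the constant field when the `k`-block of `x` does not wrap around the
torus past the corner `o` (`n_μ(ȳ − o) + Lᵏ ≤ |T_ε|_μ`; `k ≤ K`): the staircases from `o` to `x` and to `ȳ` differ by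
`x_μ − ȳ_μ` steps in each direction — print's «U(A₀(Γ_{x,y}))», «φ(y′) = U(A₀(Γ_{y′,y}))φ′(y′)» bookkeeping with the gauge based
at `o` (F1's `cornerGauge o c = ε·A₀(Γ_{o,·})`). [cite: Balaban1982Higgs2, Lemma 2.4 proof (2.74) p.573]
[cite: Balaban1982Higgs1, (2.1)–(2.3) p.608] -/
theorem contourSum_constVec_sub (hk : k ≤ P.K) (o : HiggsLattice.Site P 0) (c : Fin P.d → ℝ) (x : HiggsLattice.Site P 0)
    (h : ∀ μ, (toFinest (blockIter k x) μ - o μ).val + P.L ^ k ≤ P.sitesPerDir 0 μ) :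
    contourSum (constVec c) o x - contourSum (constVec c) o (toFinest (blockIter k x))
      = multiContourSum (constVec c) k x := by
  rw [contourSum_constVec, contourSum_constVec, multiContourSum_constVec hk, ← Finset.sum_sub_distrib]
  refine Finset.sum_congr rfl fun μ _ => ?_
  rw [← sub_mul]
  congr 1
  have hsplit : x μ - o μ = (toFinest (blockIter k x) μ - o μ) + (x μ - toFinest (blockIter k x) μ) := by ring
  have hlt : (toFinest (blockIter k x) μ - o μ).val + (x μ - toFinest (blockIter k x) μ).val < P.sitesPerDir 0 μ :=
    lt_of_lt_of_le (Nat.add_lt_add_left (val_sub_toFinest_blockIter_lt hk x μ) _) (h μ)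
  rw [hsplit, ZMod.val_add_of_lt hlt, Nat.cast_add]
  ring

variable (C : ChargeData N)

/-- **THE TWO ROTATIONS COMPOSE TO PRINT'S TRANSPORTER**: `U(A₀(Γ_{x,o}))·(U(λ_o(ȳ))φ(ȳ)) = U(A₀(Γ^{(k)}_{x,ȳ}))φ(ȳ) = (Q_k^*(A₀)φ)(x)`
— the rotation `U(A₀(Γ_{x,o}))` of (2.74) applied to the gauged field's value `φ′(ȳ) = U(λ_o(ȳ))φ(ȳ)` («φ′(y) = φ(y)» up to the
base point) is print's «U(A₀(Γ_{x,y}))φ(y)» of (2.65), i.e. the carrier's `(Q_k^*(A₀)φ)(x)` (no wrap past `o`; `k ≤ K`).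
[cite: Balaban1982Higgs2, Lemma 2.4 proof (2.74)–(2.76) p.573 «taking into account the equalities φ′(y) = φ(y), U(A₀(Γ_{x,y}))φ(y) = …»]
[cite: Balaban1982Higgs2, Lemma 2.4 (2.65) p.572] -/
theorem transport_cornerGauge_eq_avgQkAdj (hk : k ≤ P.K) (o : HiggsLattice.Site P 0) (c : Fin P.d → ℝ)
    (φ : HiggsLattice.ScalarField P k N) (x : HiggsLattice.Site P 0)
    (h : ∀ μ, (toFinest (blockIter k x) μ - o μ).val + P.L ^ k ≤ P.sitesPerDir 0 μ) :
    C.U (P.mesh 0) (-contourSum (constVec c) o x) (rot C (fun y => cornerGauge o c (toFinest y)) φ (blockIter k x))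
      = avgQkAdj C (constVec c) k φ x := by
  have hrot : rot C (fun y => cornerGauge o c (toFinest y)) φ (blockIter k x)
      = C.U (P.mesh k) ((P.mesh k)⁻¹ * cornerGauge o c (toFinest (blockIter k x))) (φ (blockIter k x)) := rfl
  have hR : avgQkAdj C (constVec c) k φ x
      = star (C.U (P.mesh 0) (multiContourSum (constVec c) k x)) (φ (blockIter k x)) := rfl
  rw [hrot, ← U_angle_eq C (P.mesh_pos 0).ne' (P.mesh_pos k).ne', (U_cornerGauge C o c _).1, ← U_add_apply, hR,
    ChargeData.star_U, ← contourSum_constVec_sub hk o c x h]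
  congr 2
  ring

/-- **`Q_k^*(A)` VERSUS `Q_k^*(B)` AT A POINT**: if `|A_b − B_b| ≤ s` on every bond starting in the block `Bᵏ(ȳ)` of `x` (`k ≤ K`),
then `‖(Q_k^*(A)ψ)(x) − (Q_k^*(B)ψ)(x)‖ ≤ |e|·ε·d(Lᵏ − 1)·s·|ψ(ȳ)|` — the bonds of `Γ^{(k)}_{ȳ,x}` start in `Bᵏ(ȳ)`, the contour has
fewer than `dLᵏ` bonds, `‖U(εea) − 1‖ ≤ |εea|`; print's «U(A₀(Γ_{x,y}))φ(y) = U(A^{(k)}(Γ_{x,y}))φ(y) + O((Lᵏε)^{κ₀})» with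
`A^{(k)} − A₀ = O(p(Lᵏε)r(Lᵏε))` on `□`. [cite: Balaban1982Higgs2, Lemma 2.4 proof p.573 «U(A₀(Γ_{x,y}))φ(y) = U(A^{(k)}(Γ_{x,y}))φ(y) + O((Lᵏε)^{κ₀})»]
[cite: Balaban1982Higgs1, (2.2) p.608] -/
theorem norm_avgQkAdj_sub_avgQkAdj_le (hk : k ≤ P.K) {A B : HiggsLattice.VecField P 0} {s : ℝ} (hs : 0 ≤ s)
    (x : HiggsLattice.Site P 0)
    (hAB : ∀ b : HiggsLattice.PBond P 0, blockIter k b.src = blockIter k x → |A b - B b| ≤ s)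
    (ψ : HiggsLattice.ScalarField P k N) :
    ‖avgQkAdj C A k ψ x - avgQkAdj C B k ψ x‖
      ≤ |C.e| * P.mesh 0 * (P.d * ((P.L : ℝ) ^ k - 1)) * s * ‖ψ (blockIter k x)‖ := by
  set w := ψ (blockIter k x) with hw
  set α := multiContourSum A k x with hα
  set β := multiContourSum B k x with hβ
  have hA : avgQkAdj C A k ψ x = C.U (P.mesh 0) (-α) w := by
    have h : avgQkAdj C A k ψ x = star (C.U (P.mesh 0) (multiContourSum A k x)) (ψ (blockIter k x)) := rfl
    rw [h, ChargeData.star_U]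
  have hB : avgQkAdj C B k ψ x = C.U (P.mesh 0) (-α) (C.U (P.mesh 0) (α - β) w) := by
    have h : avgQkAdj C B k ψ x = star (C.U (P.mesh 0) (multiContourSum B k x)) (ψ (blockIter k x)) := rfl
    rw [h, ChargeData.star_U, ← U_add_apply]
    congr 2
    rw [hβ]
    ring
  have hlen : |α - β| ≤ (P.d * ((P.L : ℝ) ^ k - 1)) * s := by
    rw [hα, hβ, ← multiContourSum_sub]
    refine (abs_multiContourSum_le (A - B) k x (β := s) fun i hik ν t ht => ?_).trans
      (mul_le_mul_of_nonneg_right (sum_steps_le hk x) hs)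
    exact hAB _ (blockIter_stair_src hik hk x ν ht)
  rw [hA, hB, ← map_sub, norm_U_apply, norm_sub_rev]
  calc ‖C.U (P.mesh 0) (α - β) w - w‖ ≤ |P.mesh 0 * C.e * (α - β)| * ‖w‖ := norm_U_apply_sub_le C _ _ w
    _ = P.mesh 0 * |C.e| * |α - β| * ‖w‖ := by
        rw [abs_mul, abs_mul, abs_of_pos (P.mesh_pos 0)]
    _ ≤ P.mesh 0 * |C.e| * ((P.d * ((P.L : ℝ) ^ k - 1)) * s) * ‖w‖ :=
        mul_le_mul_of_nonneg_right (mul_le_mul_of_nonneg_left hlen (mul_nonneg (P.mesh_pos 0).le (abs_nonneg _)))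
          (norm_nonneg _)
    _ = |C.e| * P.mesh 0 * (P.d * ((P.L : ℝ) ^ k - 1)) * s * ‖ψ (blockIter k x)‖ := by rw [hw]; ring

end Transport

end Literature.MathematicalPhysics.QuantumFieldTheory.Balaban1983to89.B2Eq276HiggsRegion

end
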